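import Summits.QuantumFields.BalabanUV.T4Continuum.Support.NE7BorderedHessianOnSliceSU2
import HarnessLib

/-!
# NE7HessianFloorModGaugeSU3 — THE SU(3) TWINS OF G8 AND G13 (d = 4, L = 2, `card n = 3`, `0 < ε ≤ 10⁻⁵³`, every level `j`, every volume `N`, NO displayed hypothesis): row NE3-R2's class
# slice Poincaré at `card n = 3` (✓ `NE3ClassSlicePoincare.lines_d4_L2_c3`: `C_P = CPLine 4 2 3 10⁻¹⁷ 10⁻⁵³ ≤ 2776·10¹⁴`) assembled here as `classSlicePoincare_SU3`, `mC 4 2 3 ≤ 2·10¹⁵`, and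
# then **`exists_cornerGauge_hess_floor_SU3`** (the Hessian half of the sliced curved lower bound) and **`bordered_hessian_attained_on_slice_SU3`** (the bordered Hessian of the constrained
# minimal action attained on a slice representative with the floor — (G′) reduced to the multiplier letter) for the physical gauge group SU(3) (lineage `b2b-balaban-t4-ne7-p1`, gen 118, file G14)

Cell `pub-balaban`, rung (B)+1 sub-cell t4, CRUX PROVER NE7 #1 (OWNER of row NE7), generation 118.  WHAT ([folklore]; 0 def, 0 sorry; `n : Type`, `card n = 3`): `mC_4_2_3_le`, `classSlicePoincare_SU3`
(row NE3-R2's `classSlicePoincare_of_lines` with the `card n = 3` lines — the SU(3) twin of their `classSlicePoincare_SU2`), `exists_cornerGauge_hess_floor_SU3`, `bordered_hessian_attained_on_slice_SU3`.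
HONEST FRAMING: numeric instantiation of landed kernel theorems about OUR minimisers; the multiplier term is NOT bounded — (G′) NOT proved; nothing of Bałaban's asserted; NOT NE7 as a spine
node, NOT NE3; spine 0∕9; finite T⁴ rung (B)+1 — NOT infinite volume, NOT mass gap, NOT BetaPertH, NOT Clay.
-/

set_option autoImplicit false

open scoped BigOperators Matrix Matrix.Norms.L2Operator Topology
open NormedSpace Finset Set Filter Metric

namespace Summit.QuantumFields.BalabanUV.T4Continuum.NE7HessianFloorModGaugeSU3

open Literature.MathematicalPhysics.QuantumFieldTheory.Balaban1983to89
open B7Prop1Explicit B7Prop2Explicit MatrixLog UnitaryModel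
open T4AveragingDeficitWall (IsUnitaryCfg IsSkewDir SmallField Ad curl curlAt curlSq dirSq)
open T4AveragingDeficitWallBoundary (IsPeriodicCfg periodBox)
open AveragingDeficitTorusChart (TDir chart chartDir resDir)
open AveragingDeficitTwoLevelPrep (twoLevelSmall skewSub skewPR)
open AveragingDeficitMultiLevelPrep (cavgIter tower levelQ levelQ' LevelSmall)
open MatrixNorms (nhsNormSq)
open MinimalActionLevels (perWin stepWt)
open MinimalActionSandwich (IsMinimiser minAct)
open MinimalActionRate (sfClass)
open NE3HessForm (hess)
open NE7RadIterUniform (radD levelSmall_of_class_radius)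
open NE7StraightTowerCurlEnergy (eC mC)
open NE7QbarMassLetter (massErrC massRemC)
open BlockAveragePushDirGauge (gaugeDir)
open NE3QbarIterCovLiftPrep (cruxC)
open NE3RightInverseSolveLetters (thetaLoc cruxC_le_thetaLoc cruxC_nonneg)
open NE3SlicePoincareShape (SlicePoincare)
open NE3FrameFreeSliceW (frameFreeBlockLandauW)
open NE3EnergyRateWSupOfSlicePoincare (tower_eq_mul_pow)
open NE3SlicePoincareBudgetLine (CPLine)
open NE3ClassSlicePoincare (classSlicePoincare_of_lines lines_d4_L2_c2 lines_d4_L2_c3)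
open NE3ClassRadiusFamily (CPLine_nonneg)
open NE7RoutePiRegimeSU2 (thetaLoc_4_2_lt thetaLoc_mul_lt_one)
open NE7SliceRepHessianFloor (liftMassC liftCurlC)
open NE7HessianFloorModGauge (exists_cornerGauge_hess_floor)
open NE7HessianFloorModGaugeSU2 (classRadius_eq_div)
open NE7BorderedHessianOnSlice (bordered_hessian_attained_on_slice)

noncomputable section

variable {n : Type} [Fintype n] [DecidableEq n]

/-! ## §1 The SU(3) numeric lines -/

omit [Fintype n] [DecidableEq n] in
/-- `mC 4 2 3 ≤ 2·10¹⁵` (`√massErrC 4 2 ≤ 1.2·10⁷`, `massRemC 4 2 = 27568`, `√3 ≤ 7∕4`). [folklore] -/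
theorem mC_4_2_3_le : mC 4 2 3 ≤ 2 * 10 ^ 15 := by
  have h1 : Real.sqrt (massErrC 4 2) ≤ 12000000 := by
    rw [Real.sqrt_le_left (by norm_num)]
    unfold massErrC; norm_num
  have h2 : massRemC 4 2 = 27568 := by unfold massRemC; norm_num
  have h3 : Real.sqrt 3 ≤ 7 / 4 := by
    rw [Real.sqrt_le_left (by norm_num)]; norm_num
  have h0 : 0 ≤ Real.sqrt (massErrC 4 2) := Real.sqrt_nonneg _
  have h0' : 0 ≤ Real.sqrt 3 := Real.sqrt_nonneg _
  unfold mC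
  rw [h2]
  have h4 : (16 * (((4 : ℕ) : ℝ) + 1) * (((4 : ℕ) : ℝ) + 4) * (((2 : ℕ) : ℝ)) ^ 2) = 2560 := by norm_num
  rw [h4]
  calc Real.sqrt (massErrC 4 2) * 27568 * 2560 * Real.sqrt ((3 : ℕ) : ℝ)
      ≤ 12000000 * 27568 * 2560 * (7 / 4) := by
        have e : ((3 : ℕ) : ℝ) = 3 := by norm_num
        rw [e]
        exact mul_le_mul (mul_le_mul_of_nonneg_right (mul_le_mul_of_nonneg_right h1 (by norm_num : (0:ℝ) ≤ 27568)) (by norm_num : (0:ℝ) ≤ 2560)) h3 h0' (by positivity)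
    _ ≤ 2 * 10 ^ 15 := by norm_num

omit [Fintype n] [DecidableEq n] in
/-- `0 ≤ CPLine 4 2 3 10⁻¹⁷ 10⁻⁵³`. [folklore] -/
theorem CPLine_nonneg_d4_L2_c3 : 0 ≤ CPLine 4 2 3 (1 / 10 ^ 17) (1 / 10 ^ 53) :=
  CPLine_nonneg (by norm_num) (by norm_num) (by norm_num) (by norm_num)

/-- **(P♮)_W ON THE CLASS AT `d = 4`, `L = 2`, SU(3), WITH NO NUMERIC HYPOTHESIS BUT `ε ≤ 10⁻⁵³`** (row NE3-R2's ✓ `classSlicePoincare_of_lines` with ✓ `lines_d4_L2_c3` and the third line of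
✓ `lines_d4_L2_c2`; constant `CPLine 4 2 3 10⁻¹⁷ 10⁻⁵³ ≤ 2776·10¹⁴`). [folklore] -/
theorem classSlicePoincare_SU3 [Nonempty n] (hn : Fintype.card n = 3) {N : ℕ} (hN : 1 ≤ N) {ε : ℝ} (hε : 0 < ε)
    (hε' : ε ≤ 1 / 10 ^ 53) (hsmall : ∀ j : ℕ, LevelSmall 4 2 (j + 1) (ε / (((2 : ℕ) : ℝ) ^ (j + 2)) ^ 2)) :
    ∀ j : ℕ, ∀ W : Site 4 → Fin 4 → (Matrix n n ℂ)ˣ, W ∈ sfClass (d := 4) 2 N ε (j + 1) →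
      SlicePoincare 2 (j + 1) W (frameFreeBlockLandauW (d := 4) (n := n) 2 N (j + 1) W) (CPLine 4 2 3 (1 / 10 ^ 17) (1 / 10 ^ 53))
        (periodBox (N * 2 ^ (j + 1))) := by
  obtain ⟨h1, h2, h4, -⟩ := lines_d4_L2_c3
  obtain ⟨-, -, h3, -, -⟩ := lines_d4_L2_c2
  have h := classSlicePoincare_of_lines (n := n) (d := 4) (L := 2) (by norm_num) (by norm_num) hN hε hε'
    (by norm_num : (0 : ℝ) < 1 / 10 ^ 17) hsmall
  rw [hn] at h
  exact h h1 h2 h3 h4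

/-! ## §2 The Hessian floor modulo corner-trivial gauge directions, SU(3), `L = 2` -/

/-- **THE HESSIAN HALF OF THE SLICED CURVED LOWER BOUND, d = 4, L = 2, SU(3), NO DISPLAYED HYPOTHESIS BUT `0 < ε ≤ 10⁻⁵³`** (see the module docstring). [cite: Balaban1985Averaging, (48) p.25;
Balaban1985PropagatorsII, Thm 3.3 (3.46); Balaban1985Variational, (83) p.290] -/
theorem exists_cornerGauge_hess_floor_SU3 [Nonempty n] (hn : Fintype.card n = 3) {N : ℕ} [NeZero N] (hN : 1 ≤ N) {ε : ℝ} (hε : 0 < ε) (hε' : ε ≤ 1 / 10 ^ 53) (j : ℕ)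
    {U : Site 4 → Fin 4 → (Matrix n n ℂ)ˣ} (hU : IsUnitaryCfg U) (hUP : IsPeriodicCfg U ((tower 2 N (j + 1) : ℕ) : ℤ))
    (hUx : SmallField U (ε * ((((2 : ℕ) : ℝ) ^ 2)⁻¹) ^ (j + 1))) {θ : ℝ} (hθ : 0 < θ) (X : ↥(skewSub 4 n (2 * tower 2 N j))) :
    ∃ mu : Site 4 → Matrix n n ℂ, (∀ y, mu y ∈ skewAdjoint (Matrix n n ℂ))
      ∧ (∀ (y : Site 4) (i : Fin 4), mu (y + ((2 * tower 2 N j : ℕ) : ℤ) • e i) = mu y)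
      ∧ (∀ w : Site 4, mu (((2 : ℤ) ^ (j + 1)) • w) = 0)
      ∧ levelQ' 2 N j U ((X + skewPR (d := 4) (n := n) (2 * tower 2 N j) (resDir (2 * tower 2 N j) (gaugeDir U mu)) : ↥(skewSub 4 n (2 * tower 2 N j)))
            : TDir 4 n (2 * tower 2 N j)) = levelQ' 2 N j U (X : TDir 4 n (2 * tower 2 N j))
      ∧ ∑ P ∈ perWin 4 N, nhsNormSq
          (curl (cavgIter 2 (j + 1) U) (chartDir (ContinuousLinearMap.id ℝ (Matrix n n ℂ)) N ((levelQ' 2 N j U (X : TDir 4 n (2 * tower 2 N j)) : ↥(skewSub 4 n N)) : TDir 4 n N)) P)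
        ≤ ((1 + θ) + 2 * ((1 + θ) * (14 * (Fintype.card (T4AveragingDeficitWall.Plane 4) : ℝ) * ε) + (1 + θ⁻¹) * (36 * eC 4 2 (Fintype.card n) ^ 2 * ε ^ 2))
              * (4 * CPLine 4 2 3 (1 / 10 ^ 17) (1 / 10 ^ 53) * Fintype.card n))
            * hess U (chartDir (ContinuousLinearMap.id ℝ (Matrix n n ℂ)) (2 * tower 2 N j)
                  ((X + skewPR (d := 4) (n := n) (2 * tower 2 N j) (resDir (2 * tower 2 N j) (gaugeDir U mu)) : ↥(skewSub 4 n (2 * tower 2 N j))) : TDir 4 n (2 * tower 2 N j)))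
                (chartDir (ContinuousLinearMap.id ℝ (Matrix n n ℂ)) (2 * tower 2 N j)
                  ((X + skewPR (d := 4) (n := n) (2 * tower 2 N j) (resDir (2 * tower 2 N j) (gaugeDir U mu)) : ↥(skewSub 4 n (2 * tower 2 N j))) : TDir 4 n (2 * tower 2 N j)))
                (perWin 4 (tower 2 N (j + 1)))
          + 2 * ((1 + θ) * (14 * (Fintype.card (T4AveragingDeficitWall.Plane 4) : ℝ) * ε) + (1 + θ⁻¹) * (36 * eC 4 2 (Fintype.card n) ^ 2 * ε ^ 2))
              * ((2 * liftMassC 4 2 + 4 * CPLine 4 2 3 (1 / 10 ^ 17) (1 / 10 ^ 53) * liftCurlC 4 2)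
                  * dirSq (chartDir (ContinuousLinearMap.id ℝ (Matrix n n ℂ)) N ((levelQ' 2 N j U (X : TDir 4 n (2 * tower 2 N j)) : ↥(skewSub 4 n N)) : TDir 4 n N))
                      (periodBox N)) := by
  have hε0 : 0 ≤ ε := hε.le
  have hε1 : ε ≤ 1 := hε'.trans (by norm_num)
  -- the k-free ε-lines in numbers
  have hεD : 4 * ε * radD 4 2 * (((((2 : ℕ) : ℝ)) ^ 2)⁻¹) ^ 2 ≤ 1 := by
    have e : radD 4 2 = 370278400 := by unfold radD; norm_num
    rw [e]; norm_num; linarith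
  have hεT : twoLevelSmall 4 2 * (2 * ε * ((((2 : ℕ) : ℝ)) ^ 2)⁻¹) ≤ 1 := by
    unfold twoLevelSmall; norm_num; linarith
  have hεM : 8 * (((2 : ℕ) : ℝ)) * mC 4 2 (Fintype.card n) * ε * ((((2 : ℕ) : ℝ)) ^ 2)⁻¹ ≤ 1 := by
    rw [hn]
    have hm := mC_4_2_3_le
    have e : 8 * (((2 : ℕ) : ℝ)) * mC 4 2 ((3 : ℕ) : ℝ) * ε * ((((2 : ℕ) : ℝ)) ^ 2)⁻¹ = 4 * (mC 4 2 3 * ε) := by push_cast; ring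
    rw [e]
    have : mC 4 2 3 * ε ≤ 2 * 10 ^ 15 * (1 / 10 ^ 53) := mul_le_mul hm hε' hε0 (by norm_num)
    linarith
  have hθL := thetaLoc_4_2_lt
  have hθ0 : 0 ≤ thetaLoc 4 2 := (cruxC_nonneg 4 2).trans (cruxC_le_thetaLoc 4 2)
  have hθl2 : thetaLoc 4 2 * ε ≤ 1 / 2 := by
    have : thetaLoc 4 2 * ε ≤ 10 ^ 19 * (1 / 10 ^ 53) := mul_le_mul hθL.le hε' hε0 (by norm_num)
    linarith
  have hcrux : cruxC 4 2 * ε < 1 := lt_of_le_of_lt (mul_le_mul_of_nonneg_right (cruxC_le_thetaLoc 4 2) hε0) (thetaLoc_mul_lt_one hε hε')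
  have hEl : 43584 * ε ≤ 1 / 2 := by linarith
  -- row NE3-R2's class slice Poincaré, SU(3), L = 2
  have hsmall : ∀ k : ℕ, LevelSmall 4 2 (k + 1) (ε / ((((2 : ℕ) : ℝ)) ^ (k + 2)) ^ 2) := by
    intro k
    rw [classRadius_eq_div]
    exact (levelSmall_of_class_radius (d := 4) (L := 2) (by norm_num) hε0 hεD hεT (k + 1)).1
  have hmem : U ∈ MinimalActionRate.sfClass (d := 4) 2 N ε (j + 1) := by
    refine ⟨hU, ?_, ?_⟩
    · rw [← tower_eq_mul_pow]; exact hUP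
    · rw [classRadius_eq_div]; exact hUx
  have hSP := classSlicePoincare_SU3 hn hN hε hε' hsmall j U hmem
  have hCP := CPLine_nonneg_d4_L2_c3
  obtain ⟨-, -, -, hCPle⟩ := lines_d4_L2_c3
  have habs : 28 * (Fintype.card (T4AveragingDeficitWall.Plane 4) : ℝ) * ε * (4 * CPLine 4 2 3 (1 / 10 ^ 17) (1 / 10 ^ 53) * Fintype.card n) ≤ 1 := by
    rw [hn, show Fintype.card (T4AveragingDeficitWall.Plane 4) = 6 from by rfl]
    have : ε * CPLine 4 2 3 (1 / 10 ^ 17) (1 / 10 ^ 53) ≤ (1 / 10 ^ 53) * (2776 * 10 ^ 14) := mul_le_mul hε' hCPle hCP (by norm_num)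
    push_cast
    nlinarith
  exact exists_cornerGauge_hess_floor (L := 2) (by norm_num) hN hε0 hεD hεT hεM hε1 hcrux hθl2 hEl j hU hUP hUx hCP hSP habs hθ X

/-! ## §3 The bordered Hessian attained on the slice, SU(3), `L = 2` -/

/-- **THE BORDERED HESSIAN ATTAINED ON THE SLICE WITH THE FLOOR — SU(3), L = 2, NO DISPLAYED HYPOTHESIS** (see the module docstring). [cite: Balaban1985Variational, Thm 1 p.279, (83) p.290;
Balaban1985Averaging, (48) p.25; Balaban1985PropagatorsII, Thm 3.3 (3.46)] -/
theorem bordered_hessian_attained_on_slice_SU3 [Nonempty n] (hn : Fintype.card n = 3) :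
    ∃ ε₀ : ℝ, 0 < ε₀ ∧ ∀ ε : ℝ, 0 < ε → ε ≤ ε₀ →
      ∀ (N : ℕ) [NeZero N], 1 ≤ N → ∀ j : ℕ,
      ∃ δV : ℝ, 0 < δV ∧
        ∀ V₀ ∈ {V : Site 4 → Fin 4 → (Matrix n n ℂ)ˣ | IsUnitaryCfg V ∧ IsPeriodicCfg V (N : ℤ) ∧ SmallField V δV},
        ∀ Us : Site 4 → Fin 4 → (Matrix n n ℂ)ˣ, IsMinimiser 4 (sfClass 4 2 N ε) 2 N (j + 1) V₀ Us → ∀ θ : ℝ, 0 < θ →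
        ∀ v : ↥(skewSub 4 n N), ∃ Xs : ↥(skewSub 4 n (2 * tower 2 N j)),
          levelQ' 2 N j Us (Xs : TDir 4 n (2 * tower 2 N j)) = v
          ∧ fderiv ℝ (fderiv ℝ (fun y : ↥(skewSub 4 n N) => minAct 4 (sfClass 4 2 N ε) 2 N (j + 1) (chart (ContinuousLinearMap.id ℝ (Matrix n n ℂ)) N V₀ (y : TDir 4 n N)))) 0 v v
              = ((stepWt 4 2)⁻¹) ^ (j + 1) * hess Us (chartDir (ContinuousLinearMap.id ℝ (Matrix n n ℂ)) (2 * tower 2 N j) (Xs : TDir 4 n (2 * tower 2 N j)))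
                    (chartDir (ContinuousLinearMap.id ℝ (Matrix n n ℂ)) (2 * tower 2 N j) (Xs : TDir 4 n (2 * tower 2 N j))) (perWin 4 (tower 2 N (j + 1)))
                - fderiv ℝ (fun y : ↥(skewSub 4 n N) => minAct 4 (sfClass 4 2 N ε) 2 N (j + 1) (chart (ContinuousLinearMap.id ℝ (Matrix n n ℂ)) N V₀ (y : TDir 4 n N))) 0
                    (fderiv ℝ (fderiv ℝ (fun Φ : ↥(skewSub 4 n (2 * tower 2 N j)) =>
                      levelQ 2 N j Us (chart (ContinuousLinearMap.id ℝ (Matrix n n ℂ)) (2 * tower 2 N j) Us (Φ : TDir 4 n (2 * tower 2 N j))))) 0 Xs Xs)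
          ∧ ∑ P ∈ perWin 4 N, nhsNormSq (curl V₀ (chartDir (ContinuousLinearMap.id ℝ (Matrix n n ℂ)) N (v : TDir 4 n N)) P)
              ≤ ((1 + θ) + 2 * ((1 + θ) * (14 * (Fintype.card (T4AveragingDeficitWall.Plane 4) : ℝ) * ε) + (1 + θ⁻¹) * (36 * eC 4 2 (Fintype.card n) ^ 2 * ε ^ 2))
                    * (4 * CPLine 4 2 3 (1 / 10 ^ 17) (1 / 10 ^ 53) * Fintype.card n))
                  * hess Us (chartDir (ContinuousLinearMap.id ℝ (Matrix n n ℂ)) (2 * tower 2 N j) (Xs : TDir 4 n (2 * tower 2 N j)))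
                      (chartDir (ContinuousLinearMap.id ℝ (Matrix n n ℂ)) (2 * tower 2 N j) (Xs : TDir 4 n (2 * tower 2 N j))) (perWin 4 (tower 2 N (j + 1)))
                + 2 * ((1 + θ) * (14 * (Fintype.card (T4AveragingDeficitWall.Plane 4) : ℝ) * ε) + (1 + θ⁻¹) * (36 * eC 4 2 (Fintype.card n) ^ 2 * ε ^ 2))
                    * ((2 * liftMassC 4 2 + 4 * CPLine 4 2 3 (1 / 10 ^ 17) (1 / 10 ^ 53) * liftCurlC 4 2)
                        * dirSq (chartDir (ContinuousLinearMap.id ℝ (Matrix n n ℂ)) N (v : TDir 4 n N)) (periodBox N))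
          ∧ (((2 : ℕ) : ℝ)⁻¹) ^ (2 * (j + 1)) * dirSq (chartDir (ContinuousLinearMap.id ℝ (Matrix n n ℂ)) (2 * tower 2 N j) (Xs : TDir 4 n (2 * tower 2 N j))) (periodBox (tower 2 N (j + 1)))
              ≤ 2 * (4 * CPLine 4 2 3 (1 / 10 ^ 17) (1 / 10 ^ 53) * Fintype.card n)
                  * hess Us (chartDir (ContinuousLinearMap.id ℝ (Matrix n n ℂ)) (2 * tower 2 N j) (Xs : TDir 4 n (2 * tower 2 N j)))
                      (chartDir (ContinuousLinearMap.id ℝ (Matrix n n ℂ)) (2 * tower 2 N j) (Xs : TDir 4 n (2 * tower 2 N j))) (perWin 4 (tower 2 N (j + 1)))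
                + 2 * ((2 * liftMassC 4 2 + 4 * CPLine 4 2 3 (1 / 10 ^ 17) (1 / 10 ^ 53) * liftCurlC 4 2)
                    * dirSq (chartDir (ContinuousLinearMap.id ℝ (Matrix n n ℂ)) N (v : TDir 4 n N)) (periodBox N)) := by
  obtain ⟨ε₁, hε₁, H⟩ := bordered_hessian_attained_on_slice (n := n) (L := 2) (by norm_num)
  refine ⟨min ε₁ (1 / 10 ^ 53), lt_min hε₁ (by norm_num), fun ε hε hεle N _ hN j => ?_⟩
  have hε' : ε ≤ 1 / 10 ^ 53 := hεle.trans (min_le_right _ _)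
  have hε0 : 0 ≤ ε := hε.le
  -- the k-free ε-lines in numbers (d = 4, L = 2, card n = 2)
  have hεD2 : 4 * (2 * ε) * radD 4 2 * (((((2 : ℕ) : ℝ)) ^ 2)⁻¹) ^ 2 ≤ 1 := by
    have e : radD 4 2 = 370278400 := by unfold radD; norm_num
    rw [e]; norm_num; linarith
  have hεT2 : twoLevelSmall 4 2 * (2 * (2 * ε) * ((((2 : ℕ) : ℝ)) ^ 2)⁻¹) ≤ 1 := by
    unfold twoLevelSmall; norm_num; linarith
  have hεM : 8 * (((2 : ℕ) : ℝ)) * mC 4 2 (Fintype.card n) * ε * ((((2 : ℕ) : ℝ)) ^ 2)⁻¹ ≤ 1 := by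
    rw [hn]
    have hm := mC_4_2_3_le
    have e : 8 * (((2 : ℕ) : ℝ)) * mC 4 2 ((3 : ℕ) : ℝ) * ε * ((((2 : ℕ) : ℝ)) ^ 2)⁻¹ = 4 * (mC 4 2 3 * ε) := by push_cast; ring
    rw [e]
    have : mC 4 2 3 * ε ≤ 2 * 10 ^ 15 * (1 / 10 ^ 53) := mul_le_mul hm hε' hε0 (by norm_num)
    linarith
  have hε1 : ε ≤ 1 := hε'.trans (by norm_num)
  have hθL := thetaLoc_4_2_lt
  have hθl2 : thetaLoc 4 2 * ε ≤ 1 / 2 := by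
    have : thetaLoc 4 2 * ε ≤ 10 ^ 19 * (1 / 10 ^ 53) := mul_le_mul hθL.le hε' hε0 (by norm_num)
    linarith
  have hcrux : cruxC 4 2 * ε < 1 := lt_of_le_of_lt (mul_le_mul_of_nonneg_right (cruxC_le_thetaLoc 4 2) hε0) (thetaLoc_mul_lt_one hε hε')
  have hEl : 43584 * ε ≤ 1 / 2 := by linarith
  obtain ⟨δV, hδV, hall⟩ := H ε hε (hεle.trans (min_le_left _ _)) hεD2 hεT2 hεM hε1 hcrux hθl2 hEl N hN j
  refine ⟨δV, hδV, fun V₀ hV₀ Us hUs θ hθ v => ?_⟩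
  -- the slice Poincaré at the minimiser (a class configuration)
  have hεD : 4 * ε * radD 4 2 * (((((2 : ℕ) : ℝ)) ^ 2)⁻¹) ^ 2 ≤ 1 := by
    have e : radD 4 2 = 370278400 := by unfold radD; norm_num
    rw [e]; norm_num; linarith
  have hεT : twoLevelSmall 4 2 * (2 * ε * ((((2 : ℕ) : ℝ)) ^ 2)⁻¹) ≤ 1 := by
    unfold twoLevelSmall; norm_num; linarith
  have hsmall : ∀ k : ℕ, LevelSmall 4 2 (k + 1) (ε / ((((2 : ℕ) : ℝ)) ^ (k + 2)) ^ 2) := by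
    intro k
    rw [classRadius_eq_div]
    exact (levelSmall_of_class_radius (d := 4) (L := 2) (by norm_num) hε0 hεD hεT (k + 1)).1
  have hSP := classSlicePoincare_SU3 hn hN hε hε' hsmall j Us hUs.mem.1
  have hCP := CPLine_nonneg_d4_L2_c3
  obtain ⟨-, -, -, hCPle⟩ := lines_d4_L2_c3
  have habs : 28 * (Fintype.card (T4AveragingDeficitWall.Plane 4) : ℝ) * ε * (4 * CPLine 4 2 3 (1 / 10 ^ 17) (1 / 10 ^ 53) * Fintype.card n) ≤ 1 := by
    rw [hn, show Fintype.card (T4AveragingDeficitWall.Plane 4) = 6 from by rfl]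
    have : ε * CPLine 4 2 3 (1 / 10 ^ 17) (1 / 10 ^ 53) ≤ (1 / 10 ^ 53) * (2776 * 10 ^ 14) := mul_le_mul hε' hCPle hCP (by norm_num)
    push_cast
    nlinarith
  exact hall V₀ hV₀ Us hUs _ hCP hSP habs θ hθ v

end

end Summit.QuantumFields.BalabanUV.T4Continuum.NE7HessianFloorModGaugeSU3
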